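import Summits.QuantumFields.BalabanUV.T4Continuum.Support.NE7AllMinimisersCubeReg910Scaled
import Summits.QuantumFields.BalabanUV.T4Continuum.Support.NE7CriticalOrbitUniqueGeneric
import HarnessLib

/-!
# NE7B11Thm1ForMinimisersPrinted — [Balaban1985Variational] THEOREM 1 (TYPE) FOR THE CONSTRAINED SMALL-FIELD MINIMISERS OF ROW NE7, SECOND EDITION OF THE CAPSTONE: the two clauses
# gen 112's `NE7B11Thm1ForMinimisers.b11_thm1_sfClass` recorded as NOT claimed in print's form are now claimed in print's form — (U) «this orbit is a UNIQUE CRITICAL orbit in the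
# space (6)» (not only: unique minimal orbit), both directions (every minimiser is a critical point of the constrained problem; every critical point in the class is a minimiser
# and a gauge copy of the minimiser); (M) the regularity (9)₁₂₃^{β<1} ∧ (10) on cubes of PHYSICAL SIZE `ℓ` (print's cube-size parameter «□ of size 2ML^jη, M ≤ M(ε₁)»), constants
# linear in `ℓ`, in the regime `ℓ²ε ≤ ε₀` — together with (8)∃ (interior minimiser), for every `U(n)`, every `L ≥ 2`, `k`-uniformly, no displayed hypothesis

Cell `pub-balaban`, rung (B)+1 sub-cell t4, lineage `b2b-balaban-t4-ne7-p1` (CRUX PROVER NE7 #1 = OWNER of BINDER row NE7), generation 113.  Memo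
`t4/b2b-balaban-t4-ne7-p1-g113/ROAD-G113.md` §3.  BY NAME over ✓ p810221 `NE7HintUnconditionalGeneric.hint_small_data_generic` ((8)∃, interior), gen 113's ✓ p818723
`NE7CriticalOrbitUniqueGeneric.critical_orbit_unique_generic` ∕ `tanCritical_of_isMinimiser_smallData` ((U)), and gen 113's `NE7AllMinimisersCubeReg910Scaled.all_minimisers_cube_reg910_scaled`
((M), g112's box route at chart radius `16ℓM + 5`).  A composition: thresholds and data radii replaced by minima (`MinimalActionRate.SmallField.mono`); `ε ≤ ℓ²ε ≤ ε₀` feeds the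
`ℓ`-free thresholds.
WHAT (**`b11_thm1_sfClass_printed`**, 0 def, 0 sorry; `d = 4`, every `U(n)`, every `L ≥ 2`): `∃ C₀ C₁ C₁′ C₂ C₃ ≥ 0, ∃ ε₀ > 0, ∀ ℓ ≥ 1, ∀ ε > 0, ℓ²ε ≤ ε₀ → ∀ N ≥ 1, ∃ δ_V > 0, ∀ V (unitary,
N-periodic, SmallField V δ_V), ∀ k` (`M = L^k`): (8) an interior minimiser exists; (U∃!) `∃ U♯` minimiser with: every admissible `U′` of the class that is a critical point of the constrained
problem (level `k = j+1`: the Wilson action of the period is stationary along every periodic `𝔲(n)` direction in the kernel of the differential of the `(j+1)`-fold averaging map,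
`AveragingDeficitMultiLevelPrep.TangentIter`; level `0`: the class is the datum alone) is a minimiser and `U′^{u} = U♯` for a periodic unitary `u`; (U⇐) every minimiser at level `j+1` is
such a critical point; (9)(10) at size `ℓ`: about every point `z` a unitary `u` and a skew `A` on the cube of radius `16ℓM + 5` with `U^{u} = e^{A}`, (9)₁ `‖A‖ ≤ C₀ℓ·ε∕M`, (9)₂ `‖∇A‖ ≤
(C₁ + C₁′ℓ)·ε∕M²` (`|x − z|_∞ ≤ 8ℓM`), (10) `‖ΔA‖, ‖∂*∂A‖ ≤ C₂·ε∕M³` (`|y − z|_∞ ≤ 7ℓM`), (9)₃ `‖∇A(z₁) − ∇A(z₂)‖ ≤ C₃ℓ·(1+(1−β)⁻¹)·ε·|z₁ − z₂|_∞^β∕M^{2+β}` on `cube z (ℓM − 1)`, every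
`β < 1`.
DICTIONARY WITH PRINT (Thm 1 p. 279: constants `a₀, a₁, B₃, B₄(β₀), M(ε₁)`; «for an arbitrary configuration V satisfying (7) with ε₁ ≤ a₁ there exists a minimal orbit in the space
𝔘_k({Ω_j}, B₃ε₁) ∩ 𝔅_k(𝔅_k, V) (8). This orbit is a unique critical orbit in the space (6) if B₃ε₁ ≤ ε₀ ≤ a₀. The minimal configurations U have the regularity properties (9), (10) on cubes □
of size 2ML^jη, M ≤ M(ε₁), in a gauge u defined on a neighborhood of □»).  Ours: everywhere-small-field case (`Ω_j = T`), the space (6) = `admissible (sfClass 4 L N ε) L k V` (average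
`= V`, plaquettes within `ε∕M²` of `1`), data in the small data of radius `δ_V(n, L, ε, N)` (print: `a₁` uniform); (8)∃ interior ✓; unique CRITICAL orbit ✓ (both directions); (9)∕(10) on
cubes of physical size `≈ 2ℓ` for every `ℓ ≤ √(ε₀∕ε)` (print: `M(ε₁) ≍ ε₁⁻¹`), Hölder clause for every `β < 1` with `B₄ ∝ (1−β)⁻¹` (print: `β₀ = 1` — NOT reached, ROAD-G110 §4).
HONEST FRAMING (page 1): OUR minimisers, OUR route (gens 20–113 + the co-owner lineage's (156)–(162) + row NE3's tangent calculus); nothing of Bałaban's asserted and NOT his method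
(Sect. A induction, Sect. E contraction, regular spaces); NOT the typed `B11Thm1.Thm1At` by name; NE7 as a spine node remains the dagwriter∕referees' call; spine 0∕9; finite T⁴ rung (B)+1
— NOT infinite volume, NOT mass gap, NOT BetaPertH, NOT Clay (continuum YM on T⁴ ⇐ BetaPertH ∧ nine spine estimates).
-/

set_option autoImplicit false

open NormedSpace
open scoped BigOperators Matrix Matrix.Norms.L2Operator
open Finset

namespace Summit.QuantumFields.BalabanUV.T4Continuum.NE7B11Thm1ForMinimisersPrinted

open Literature.MathematicalPhysics.QuantumFieldTheory.Balaban1983to89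
open B7Prop1Explicit B7Prop2Explicit
open T4AveragingDeficitWall (SmallField IsUnitaryCfg IsSkewDir)
open T4AveragingDeficitWallBoundary (IsPeriodicCfg)
open AveragingDeficitPeriodicCounting (IsPeriodicDir)
open AveragingDeficitMultiLevelPrep (TangentIter)
open MinimalActionLevels (perWin)
open NE3HessForm (dAction)
open Beta.PoissonInterior (cube supNorm)
open MinimalActionSandwich (IsMinimiser admissible)
open MinimalActionRate (sfClass)
open NE3EnergyShapes (IsUnitarySite IsPeriodicSite)
open NE7HintUnconditionalGeneric (hint_small_data_generic)
open NE7CriticalOrbitUniqueGeneric (critical_orbit_unique_generic tanCritical_of_isMinimiser_smallData)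
open NE7AllMinimisersCubeReg910Scaled (all_minimisers_cube_reg910_scaled)

noncomputable section

variable {n : Type} [Fintype n] [DecidableEq n] [Nonempty n]

/-- **[Balaban1985Variational] THEOREM 1 (TYPE) FOR THE CONSTRAINED SMALL-FIELD MINIMISERS, PRINT's FORM OF THE UNIQUENESS AND CUBE-SIZE CLAUSES — existence (8), the minimal orbit is
the UNIQUE CRITICAL orbit in the space (6) (both directions), regularity (9)₁₂₃^{β<1} ∧ (10) on cubes of physical size `ℓ`** — see the module docstring for the dictionary with print and the
honest framing. [folklore] -/
theorem b11_thm1_sfClass_printed {L : ℕ} (hL : 2 ≤ L) :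
    ∃ C₀ C₁ C₁' C₂ C₃ : ℝ, 0 ≤ C₀ ∧ 0 ≤ C₁ ∧ 0 ≤ C₁' ∧ 0 ≤ C₂ ∧ 0 ≤ C₃ ∧ ∃ ε₀ : ℝ, 0 < ε₀ ∧
      ∀ (ℓ : ℕ), 1 ≤ ℓ → ∀ ε : ℝ, 0 < ε → ((ℓ : ℝ)) ^ 2 * ε ≤ ε₀ → ∀ (N : ℕ) [NeZero N], 1 ≤ N →
      ∃ δV : ℝ, 0 < δV ∧
        ∀ V ∈ {V : Site 4 → Fin 4 → (Matrix n n ℂ)ˣ | IsUnitaryCfg V ∧ IsPeriodicCfg V (N : ℤ) ∧ SmallField V δV}, ∀ k : ℕ,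
        -- (8): a minimiser exists, with plaquettes STRICTLY inside the class radius
        (∃ U : Site 4 → Fin 4 → (Matrix n n ℂ)ˣ, IsMinimiser 4 (sfClass 4 L N ε) L N k V U ∧
          ∃ a : ℝ, 0 ≤ a ∧ a < ε / ((L : ℝ) ^ k) ^ 2 ∧ SmallField U a) ∧
        -- (U∃!): the minimal orbit is the unique critical orbit in the space (6) — every critical point of the constrained problem in the class is a minimiser and a gauge copy of `U♯`
        (∃ Us : Site 4 → Fin 4 → (Matrix n n ℂ)ˣ, IsMinimiser 4 (sfClass 4 L N ε) L N k V Us ∧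
          ∀ U' ∈ admissible (sfClass 4 L N ε) L k V,
            (∀ j : ℕ, k = j + 1 → ∀ φ : Site 4 → Fin 4 → Matrix n n ℂ, IsSkewDir φ → IsPeriodicDir φ ((N * L ^ (j + 1) : ℕ) : ℤ) →
                TangentIter L j U' φ → dAction U' φ (perWin 4 (N * L ^ (j + 1))) = 0) →
            IsMinimiser 4 (sfClass 4 L N ε) L N k V U' ∧
              ∃ u : Site 4 → (Matrix n n ℂ)ˣ, IsUnitarySite u ∧ IsPeriodicSite u ((N * L ^ k : ℕ) : ℤ) ∧ gaugeAct u U' = Us) ∧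
        -- (U⇐): every minimiser is a critical point of the constrained problem
        (∀ U : Site 4 → Fin 4 → (Matrix n n ℂ)ˣ, IsMinimiser 4 (sfClass 4 L N ε) L N k V U →
          ∀ j : ℕ, k = j + 1 → ∀ φ : Site 4 → Fin 4 → Matrix n n ℂ, IsSkewDir φ → IsPeriodicDir φ ((N * L ^ (j + 1) : ℕ) : ℤ) →
            TangentIter L j U φ → dAction U φ (perWin 4 (N * L ^ (j + 1))) = 0) ∧
        -- (9), (10) on cubes of physical size `ℓ` for every minimiser about every point
        (∀ U : Site 4 → Fin 4 → (Matrix n n ℂ)ˣ, IsMinimiser 4 (sfClass 4 L N ε) L N k V U → ∀ z : Site 4,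
          ∃ (u : Site 4 → (Matrix n n ℂ)ˣ) (A : Site 4 → Fin 4 → Matrix n n ℂ), (∀ x, u x ∈ unitaryUnits (Matrix n n ℂ)) ∧
            (∀ (x : Site 4) (κ : Fin 4), (∀ i, |x i - z i| ≤ ((16 * (ℓ * L ^ k) + 5 : ℕ) : ℤ)) → gaugeAct u U x κ = expUnit (A x κ)) ∧
            (∀ (x : Site 4) (κ : Fin 4), (∀ i, |x i - z i| ≤ ((16 * (ℓ * L ^ k) + 5 : ℕ) : ℤ)) → A x κ ∈ skewAdjoint (Matrix n n ℂ)) ∧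
            (∀ (x : Site 4) (κ : Fin 4), (∀ i, |x i - z i| ≤ ((16 * (ℓ * L ^ k) + 5 : ℕ) : ℤ)) → ‖A x κ‖ ≤ C₀ * ℓ * ε / (L : ℝ) ^ k) ∧
            (∀ x : Site 4, 2 * supNorm (x - z) ≤ 16 * (ℓ * L ^ k) → ∀ κ τ : Fin 4, ‖A (x + e τ) κ - A x κ‖ ≤ (C₁ + C₁' * ℓ) * ε / ((L : ℝ) ^ k) ^ 2) ∧
            (∀ y : Site 4, supNorm (y - z) ≤ 7 * (ℓ * L ^ k) → ∀ ν : Fin 4,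
              ‖∑ i, ((A (y + e i) ν - A y ν) - (A y ν - A (y - e i) ν))‖ ≤ C₂ * ε / ((L : ℝ) ^ k) ^ 3) ∧
            (∀ y : Site 4, supNorm (y - z) ≤ 7 * (ℓ * L ^ k) → ∀ ν : Fin 4,
              ‖∑ μ, ((A y μ + A (y + e μ) ν - A (y + e ν) μ - A y ν)
                      - (A (y - e μ) μ + A (y - e μ + e μ) ν - A (y - e μ + e ν) μ - A (y - e μ) ν))‖ ≤ C₂ * ε / ((L : ℝ) ^ k) ^ 3) ∧
            (∀ β : ℝ, 0 ≤ β → β < 1 → ∀ z₁ z₂ : Site 4, z₁ ∈ cube z (ℓ * L ^ k - 1) → z₂ ∈ cube z (ℓ * L ^ k - 1) → ∀ μ κ : Fin 4,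
              ‖(A (z₁ + e μ) κ - A z₁ κ) - (A (z₂ + e μ) κ - A z₂ κ)‖
                ≤ C₃ * ℓ * (1 + (1 - β)⁻¹) * ε * (supNorm (z₁ - z₂) : ℝ) ^ β / ((L : ℝ) ^ k) ^ (2 + β))) := by
  obtain ⟨ε₁, hε₁, H1⟩ := hint_small_data_generic (n := n) hL
  obtain ⟨ε₂, hε₂, H2⟩ := critical_orbit_unique_generic (n := n) hL
  obtain ⟨ε₄, hε₄, H4⟩ := tanCritical_of_isMinimiser_smallData (n := n) hL
  obtain ⟨C₀, C₁, C₁', C₂, C₃, hC₀, hC₁, hC₁', hC₂, hC₃, ε₃, hε₃, H3⟩ := all_minimisers_cube_reg910_scaled (n := n) hL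
  refine ⟨C₀, C₁, C₁', C₂, C₃, hC₀, hC₁, hC₁', hC₂, hC₃, min ε₁ (min ε₂ (min ε₃ ε₄)), lt_min hε₁ (lt_min hε₂ (lt_min hε₃ hε₄)),
    fun ℓ hℓ ε hε hεle N _ hN => ?_⟩
  have hℓr : (1 : ℝ) ≤ (ℓ : ℝ) := by exact_mod_cast hℓ
  have hℓε : ε ≤ ((ℓ : ℝ)) ^ 2 * ε := le_mul_of_one_le_left hε.le (one_le_pow₀ hℓr)
  have hε1 : ε ≤ ε₁ := hℓε.trans (hεle.trans (min_le_left _ _))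
  have hε2 : ε ≤ ε₂ := hℓε.trans (hεle.trans ((min_le_right _ _).trans (min_le_left _ _)))
  have hε3 : ((ℓ : ℝ)) ^ 2 * ε ≤ ε₃ := hεle.trans ((min_le_right _ _).trans ((min_le_right _ _).trans (min_le_left _ _)))
  have hε4 : ε ≤ ε₄ := hℓε.trans (hεle.trans ((min_le_right _ _).trans ((min_le_right _ _).trans (min_le_right _ _))))
  obtain ⟨δ₁, hδ₁, K1⟩ := H1 ε hε hε1 N hN
  obtain ⟨δ₂, hδ₂, K2⟩ := H2 ε hε hε2 N hN
  obtain ⟨δ₃, hδ₃, K3⟩ := H3 ℓ hℓ ε hε hε3 N hN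
  obtain ⟨δ₄, hδ₄, K4⟩ := H4 ε hε hε4 N hN
  refine ⟨min δ₁ (min δ₂ (min δ₃ δ₄)), lt_min hδ₁ (lt_min hδ₂ (lt_min hδ₃ hδ₄)), fun V hV k => ?_⟩
  obtain ⟨hVu, hVp, hVs⟩ := hV
  have hV1 : V ∈ {V : Site 4 → Fin 4 → (Matrix n n ℂ)ˣ | IsUnitaryCfg V ∧ IsPeriodicCfg V (N : ℤ) ∧ SmallField V δ₁} :=
    ⟨hVu, hVp, MinimalActionRate.SmallField.mono hVs (min_le_left _ _)⟩
  have hV2 : V ∈ {V : Site 4 → Fin 4 → (Matrix n n ℂ)ˣ | IsUnitaryCfg V ∧ IsPeriodicCfg V (N : ℤ) ∧ SmallField V δ₂} :=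
    ⟨hVu, hVp, MinimalActionRate.SmallField.mono hVs ((min_le_right _ _).trans (min_le_left _ _))⟩
  have hV3 : V ∈ {V : Site 4 → Fin 4 → (Matrix n n ℂ)ˣ | IsUnitaryCfg V ∧ IsPeriodicCfg V (N : ℤ) ∧ SmallField V δ₃} :=
    ⟨hVu, hVp, MinimalActionRate.SmallField.mono hVs ((min_le_right _ _).trans ((min_le_right _ _).trans (min_le_left _ _)))⟩
  have hV4 : V ∈ {V : Site 4 → Fin 4 → (Matrix n n ℂ)ˣ | IsUnitaryCfg V ∧ IsPeriodicCfg V (N : ℤ) ∧ SmallField V δ₄} :=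
    ⟨hVu, hVp, MinimalActionRate.SmallField.mono hVs ((min_le_right _ _).trans ((min_le_right _ _).trans (min_le_right _ _)))⟩
  refine ⟨K1 V hV1 k, K2 V hV2 k, fun U hU j hj => ?_, fun U hU z => K3 V hV3 k U hU z⟩
  subst hj
  exact K4 V hV4 j U hU

end

end Summit.QuantumFields.BalabanUV.T4Continuum.NE7B11Thm1ForMinimisersPrinted
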